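import Summits.NavierStokesRegularity.NavierStokesRegularity.Theses.LandauTail
import HarnessLib.Audit

/-!
# Birth skeleton (BC3) of the crux `LandauTail.LandauTailBlowup`

Crux item `stmt-NavierStokesRegularity-1944` (decl
`Summit.NavierStokesRegularity.NavierStokesRegularity.Theses.LandauTail.LandauTailBlowup`, kind auto-crux = the
underived TARGET X of route `route-NavierStokesRegularity-LandauTail`, the single load-bearing leaf of its deciding
theorem `closes`; re-audit bin HONEST-BET-1LEAF). Tree path `Cruxes/LandauTailBlowup/Lines/birth.lean`; registrar
`planner-skel-stmt-NavierStokesRegularity-1944-0`, 2026-08-17. The route (opened 2026-08-15) predates the Lean birth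
certificate; this file supplies BC3 retroactively. Nothing here is new mathematics: it types the route's OWN declared
layer-1 cut of X ("X <= LandauTailLocal + LandauTailTransfer", route header TWO-LAYER PLAN) as a registered skeleton.

THE CUT (two named stubs, both twins BY NAME of filed, refuter-reviewed, grounded route items, so that a proof of
either item discharges the corresponding stub by `exact`):

* `stub_landauTailLocal : LandauTail.LandauTailLocal` — twin of item `stmt-NavierStokesRegularity-1946` (crux, rank 2,
  the SINGULARITY MODEL): with ν = 1 and singular point (0,0) there is a classical NS solution on ℝ³ × (−1,0) in the
  Tsai / Albritton–Barker local-energy class near the origin (sup_t ∫_{B₁}|u|² < ∞, ∫∫_{B₁}|∇u|² < ∞; NO datum, NO decay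
  at infinity) converging at the parabolic scale, √(−t)·u(t, √(−t) y) → U(y) for every y ≠ 0, to a nonzero steady
  (−1)-homogeneous profile (U,P) smooth off 0 (= a Landau solution, Sverak2011). Why it might fail (filed): no forceless
  mechanism pumping the constant momentum flux b(U) is known (KarchZheng2015 need a singular force; isolated rings
  translate rather than collapse); an asymptotic form of Tsai1998 Thm 2 (Liouville for first singularities converging
  to a homogeneous profile off 0 under local energy bounds) may hold — that refutation would itself be a theorem.
* `stub_landauTailTransfer : LandauTail.LandauTailTransfer` — twin of item `stmt-NavierStokesRegularity-1948` (crux,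
  rank 4, LOCALISATION TO CLAY DATA): if such a local-energy-class Landau-tailed first singularity exists, then one
  exists inside a finite-energy Leray–Hopf classical solution on ℝ³ × [0,T) from a rapidly decaying smooth datum (the
  truncation / exterior-stability half of every blow-up construction, isolated; Tao2011 Thm 20 localises only across
  whole-space data classes or modulo forcing, never from a solution without decay). Why it might fail (filed): NS is
  non-local; the local model may need an infinite-energy far field; finite-codimension stability of the collapse
  under truncation is unknown.

`LandauTailBlowup_of : LandauTail.LandauTailBlowup` is the ONLY theorem of this file concluding the crux (A12 layer
invariant: conclusion = the crux BY NAME, no `Prop` hypotheses, placeholders only inside the two declared stubs, which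
it uses by name). The composition is modus ponens ACROSS A DEFINITIONAL SEAM: `LandauTailTransfer` is by definition
`(body of LandauTailLocal) → (body of LandauTailBlowup)`, and the application elaborates because the three route defs
unfold to syntactically identical bodies (checked here by the kernel; the same identity
`LandauTailTransfer ↔ (LandauTailLocal → LandauTailBlowup) := Iff.rfl` was verified by refuter seat 16c1b7b0 on
2026-08-15 and is re-checked in the registrar's closed evidence file `bc/LandauTailBlowup_birth_closed.lean`, which
also carries the hypotheses form `LandauTailBlowup_of_hyps : LandauTailLocal → LandauTailTransfer → LandauTailBlowup`
with axioms ⊆ {propext, Classical.choice, Quot.sound} and no placeholder).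

HONEST NOTE ON THE SEAM. The seam is logical (model ∧ localisation), not analytic: all the blow-up analysis sits in
`stub_landauTailLocal` (the route's rank-2 crux, staffed through its own crux chain) and all the truncation /
stability analysis in `stub_landauTailTransfer` (rank 4). Neither piece is cheaply the crux or the summit — BC3 probes
(folder `bc/probe_*.lean`): for each stub S, `S → LandauTailBlowup`, `S → NavierStokesRegularity` and
`S → ¬ NavierStokesRegularity` by `first | exact? | simpa | aesop`, both with the defs folded and with them unfolded,
all FAIL — 12/12 combined probes (folded: `exact?`, `simpa` fail and `aesop` fails after exhaustive search; unfolded: heartbeat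
exhaustion at 4·10⁵) and 10/10 supplementary single-tactic probes on the unfolded goals at 10⁶ heartbeats (`exact?`:
"could not close the goal" 5/5; `aesop` with simp normalisation off: exhaustive-search failure 4/5, rule-application
cap 1/5); raw outputs quoted in `Lines/birth.md`. `LandauTailTransfer` is implied by the crux (X → (L → X)), as a piece
of a tight split should be; `LandauTailLocal` is implied by X only through the parabolic scaling / translation
covariance of the solution classes plus the Leray–Hopf local energy bounds (not attempted here).

Disproof used: none exists yet for this crux (`ledger crux ls stmt-NavierStokesRegularity-1944`: no workfiles before
this one); negatives index consulted — no refuted statement of the summit is an instance of either stub (both stubs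
are open items 1946 / 1948 of the same route, grounded 2026-08-15, status open).
-/

namespace Summit.NavierStokesRegularity.NavierStokesRegularity.Cruxes.LandauTailBlowup.Birth

set_option linter.dupNamespace false

/-- **stub 1 — `stub_landauTailLocal` (XL, OPEN; twin by name of route item `stmt-NavierStokesRegularity-1946`,
`LandauTail.LandauTailLocal`, crux rank 2: the local-energy-class Landau-tailed first singularity exists,
ν = 1, singular point (0,0), no datum / decay constraint at infinity).** -/
theorem stub_landauTailLocal :
    Summit.NavierStokesRegularity.NavierStokesRegularity.Theses.LandauTail.LandauTailLocal := by
  sorry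

/-- **stub 2 — `stub_landauTailTransfer` (L, OPEN; twin by name of route item `stmt-NavierStokesRegularity-1948`,
`LandauTail.LandauTailTransfer`, crux rank 4: localisation — a local-energy-class Landau-tailed singularity can be
reproduced inside a finite-energy Leray–Hopf classical solution from a rapidly decaying datum).** -/
theorem stub_landauTailTransfer :
    Summit.NavierStokesRegularity.NavierStokesRegularity.Theses.LandauTail.LandauTailTransfer := by
  sorry

/-- **Birth composition (the skeleton theorem).** The crux BY NAME from the two registered stubs, used by name:
`LandauTailTransfer` unfolds to `(body of LandauTailLocal) → (body of LandauTailBlowup)`, so the application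
type-checks across the definitional seam (kernel-checked delta-unfolding of the three route defs). -/
theorem LandauTailBlowup_of :
    Summit.NavierStokesRegularity.NavierStokesRegularity.Theses.LandauTail.LandauTailBlowup :=
  stub_landauTailTransfer stub_landauTailLocal

end Summit.NavierStokesRegularity.NavierStokesRegularity.Cruxes.LandauTailBlowup.Birth
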